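/- Copyright: the b2b-balaban cell (near-miss cell 7), T⁴-continuum fan-out, row NE7b owner lineage
`b2b-balaban-t4-ne7b-p1` (gen 23), node U5c, road W-RP-VAR.  Released under the licence of the surrounding project. -/
import Mathlib.Probability.Kernel.Composition.IntegralCompProd
import Mathlib.Probability.Kernel.Composition.Prod
import Mathlib.MeasureTheory.Integral.Prod
import Mathlib.Analysis.Complex.Basic

/-!
# Reflection positivity is stable under extension by a reflected pair of Markov kernels (road W-RP-VAR, row W3)

Summits-side support leaf of the T⁴-continuum cell (rung (B)+1 on a FINITE torus only; NOT infinite volume, NOT the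
mass gap, NOT the Clay statement; NOT a proof of the spine estimate NE7b).  Claim table
`t4/b2b-balaban-t4-ne7b-p1/LEAVES-NE7b.md` row W3 of the SECONDARY road W-RP-VAR (owner ruling R-OWNER-23-2;
dagwriter ruling Q36 ∕ `T4-DAG.md` v28 `T4-U5c.W-RP-VAR°`; memo `t4/b2b-balaban-t4-ne7-p2/g27/IDEAS-NE7-g27.md` §1
step S4 «RP-ext», ABSTRACT half only).

WHAT.  The memo's step (RP-ext) asks: the extended multiscale measure (fine links + block-bond variables of all
levels, produced level by level by Bałaban's averaging prescriptions) is reflection positive across block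
hyperplanes, for observables of the open positive half.  Its abstract content, in KERNEL language (the block
average of [B12] (13) is a δ-function — a pushforward, NOT a density — so the block variables must enter through
Markov kernels, not through density factors):

* (T2) MARGINALISATION `integral_fst_compProd_markov`: extending a measure `μ` by ANY Markov kernel `η` does not
  change the integral of an observable blind to the new coordinates — `∫ g(p.1) d(μ ⊗ₘ η) = ∫ g dμ`.  This is all
  that the CROSSING block bonds ever need: an observable of the open positive half does not see them.
* (T1) EXTENSION `rp_compProd_prod_comap`: let `0 ≤ ∫ F̄ · conj (F̄ ∘ θ) dμ` hold for the κ-AVERAGE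
  `F̄ ω := ∫ f (ω, y) κ(ω, dy)` of a bounded observable `f` of the base point and of the NEW positive-half
  coordinate (this is reflection positivity of `μ` applied to `F̄`, which lies in the positive class whenever `κ`
  reads positive-half data only — the instantiating seat's job); then the measure extended by the REFLECTED PAIR of
  kernels, `μ ⊗ₘ (κ ×ₖ κ.comap θ)` (positive-half coordinate drawn from `κ ω`, negative-half coordinate from
  `κ (θ ω)`), satisfies `0 ≤ ∫ f(ω, y₊) · conj f(θ ω, y₋)` — reflection positivity for the extended reflection
  `(ω, y₊, y₋) ↦ (θ ω, y₋, y₊)` on observables of `(ω, y₊)`.  Proof: Fubini for `⊗ₘ`, the product kernel splits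
  the inner integral into `F̄ ω · conj (F̄ (θ ω))`.

Iterating (T1) level by level (each level's non-crossing block bonds, the kernel of level `k` reading level-`k−1`
data of its own half) and discarding the crossing bonds by (T2) is row W4's assembly; NOTHING of Bałaban's
prescriptions is instantiated here — whether the CENTRED prescription's kernel pair is θ-reflected (`κ₋ = κ ∘ θ`,
memo (RP-ext)(ii)) is the displayed binder (RP-ext)+(VAR) of W4, and for the PRINTED corner prescription it FAILS
(located negative, `t4/T4-EST-NE7b-P1.md` §11 (11c)).  [folklore] abstract measure theory (Fröhlich–Israel–Lieb–Simon
1978 §2 ∕ Osterwalder–Seiler 1978 §2 style); no `def`, no `[cite:]` tag, nothing printed asserted.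

HONEST.  NE7b NOT proved; spine 0∕9.  HONEST DEPENDENCY (cell): continuum YM on T⁴ ⇐ BetaPertH ∧ nine spine estimates
(0/9 proved); BetaPertH ⇐ (D1) ∧ (D4) ∧ CAP+tail; G-an2-4 gates asym, D1 and NE2/3/4.  This file changes none of it. -/

open MeasureTheory ProbabilityTheory
open scoped ComplexConjugate ComplexOrder

namespace Summit.QuantumFields.BalabanUV.T4Continuum.HistoryRPTensor

noncomputable section

variable {Ω Y Z : Type*} [MeasurableSpace Ω] [MeasurableSpace Y] [MeasurableSpace Z]

/-! ## §1 (T2) Marginalisation: a Markov extension is invisible to observables blind to the new coordinate -/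

/-- **(T2) MARGINALISATION.**  For a Markov kernel `η` and an observable `g` of the base point only,
`∫ g(p.1) d(μ ⊗ₘ η) = ∫ g dμ` — the new coordinate integrates out to `1`.  (For the road: the CROSSING block-bond
variables of every level are invisible to observables of the open positive half.) [folklore] -/
theorem integral_fst_compProd_markov (μ : Measure Ω) [SFinite μ] (η : Kernel Ω Z) [IsMarkovKernel η]
    {E : Type*} [NormedAddCommGroup E] [NormedSpace ℝ E] {g : Ω → E} (hg : AEStronglyMeasurable g μ) :
    ∫ p, g p.1 ∂(μ ⊗ₘ η) = ∫ ω, g ω ∂μ := by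
  have hfst : (μ ⊗ₘ η).map Prod.fst = μ := Measure.fst_compProd μ η
  have hg' : AEStronglyMeasurable g ((μ ⊗ₘ η).map Prod.fst) := by rwa [hfst]
  rw [← integral_map measurable_fst.aemeasurable hg', hfst]

/-- (T2) for a product observable: a factor reading only the base point passes through the Markov extension
unchanged, whatever the kernel (normalisation `η ω univ = 1` is all that is used). [folklore] -/
theorem integral_fst_mul_compProd_markov (μ : Measure Ω) [SFinite μ] (η : Kernel Ω Z) [IsMarkovKernel η]
    {g h : Ω → ℂ} (hg : AEStronglyMeasurable g μ) (hh : AEStronglyMeasurable h μ) :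
    ∫ p, g p.1 * h p.1 ∂(μ ⊗ₘ η) = ∫ ω, g ω * h ω ∂μ :=
  integral_fst_compProd_markov μ η (g := fun ω => g ω * h ω) (hg.mul hh)

/-! ## §2 (T1) Extension by a reflected pair of Markov kernels preserves reflection positivity -/

omit [MeasurableSpace Ω] [MeasurableSpace Y] in
/-- Pointwise bound for the reflected product observable. [folklore] -/
theorem norm_mul_conj_le {f : Ω × Y → ℂ} {Cf : ℝ} (hfb : ∀ p, ‖f p‖ ≤ Cf) (a b : Ω × Y) :
    ‖f a * conj (f b)‖ ≤ Cf * Cf := by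
  have hC : 0 ≤ Cf := (norm_nonneg _).trans (hfb a)
  rw [norm_mul, RCLike.norm_conj]
  exact mul_le_mul (hfb a) (hfb b) (norm_nonneg _) hC

/-- The inner integral over the reflected pair of kernels SPLITS: at base point `ω`, the positive-half
coordinate is drawn from `κ ω` and the negative-half one independently from `κ (θ ω)`, so
`∫ f(ω, y₊) · conj f(θ ω, y₋) d((κ ×ₖ κ.comap θ) ω) = F̄ ω · conj (F̄ (θ ω))` with `F̄ ω := ∫ f(ω, y) κ(ω, dy)`.
[folklore] -/
theorem integral_prod_comap_eq (κ : Kernel Ω Y) [IsMarkovKernel κ] {θ : Ω → Ω} (hθ : Measurable θ)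
    (f : Ω × Y → ℂ) (ω : Ω) :
    ∫ q, f (ω, q.1) * conj (f (θ ω, q.2)) ∂((κ ×ₖ κ.comap θ hθ) ω) =
      (∫ y, f (ω, y) ∂κ ω) * conj (∫ y, f (θ ω, y) ∂κ (θ ω)) := by
  rw [Kernel.prod_apply, Kernel.comap_apply, ← integral_conj]
  exact integral_prod_mul (μ := κ ω) (ν := κ (θ ω)) (fun y => f (ω, y)) (fun y => conj (f (θ ω, y)))

/-- **(T1) EXTENSION BY A REFLECTED PAIR OF MARKOV KERNELS PRESERVES REFLECTION POSITIVITY.**  Let `μ` be a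
finite measure on `Ω`, `θ : Ω → Ω` measurable, `κ : Kernel Ω Y` Markov, and `f` a bounded measurable observable
of the base point and of ONE new coordinate.  If reflection positivity of `μ` holds for the κ-average
`F̄ ω := ∫ f(ω, y) κ(ω, dy)` — `0 ≤ ∫ F̄ · conj (F̄ ∘ θ) dμ` (hypothesis `hRP`; in the application `F̄` lies in the
positive class because `κ` reads positive-half data only) — then the measure extended by the reflected pair,
`μ ⊗ₘ (κ ×ₖ κ.comap θ)` (positive-half coordinate `y₊ ∼ κ ω`, negative-half coordinate `y₋ ∼ κ (θ ω)`), is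
reflection positive for the extended reflection `(ω, y₊, y₋) ↦ (θ ω, y₋, y₊)` on this observable:
`0 ≤ ∫ f(ω, y₊) · conj f(θ ω, y₋)`.  [folklore] -/
theorem rp_compProd_prod_comap (μ : Measure Ω) [IsFiniteMeasure μ] {θ : Ω → Ω} (hθ : Measurable θ)
    (κ : Kernel Ω Y) [IsMarkovKernel κ] {f : Ω × Y → ℂ} (hf : Measurable f) {Cf : ℝ}
    (hfb : ∀ p, ‖f p‖ ≤ Cf)
    (hRP : 0 ≤ ∫ ω, (∫ y, f (ω, y) ∂κ ω) * conj (∫ y, f (θ ω, y) ∂κ (θ ω)) ∂μ) :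
    0 ≤ ∫ p, f (p.1, p.2.1) * conj (f (θ p.1, p.2.2)) ∂(μ ⊗ₘ (κ ×ₖ κ.comap θ hθ)) := by
  -- the reflected product observable is bounded and measurable, hence integrable for the finite extended measure
  have hFm : Measurable fun p : Ω × (Y × Y) => f (p.1, p.2.1) * conj (f (θ p.1, p.2.2)) :=
    (hf.comp (measurable_fst.prodMk (measurable_fst.comp measurable_snd))).mul
      (Complex.continuous_conj.measurable.comp
        (hf.comp ((hθ.comp measurable_fst).prodMk (measurable_snd.comp measurable_snd))))
  have hFi : Integrable (fun p : Ω × (Y × Y) => f (p.1, p.2.1) * conj (f (θ p.1, p.2.2)))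
      (μ ⊗ₘ (κ ×ₖ κ.comap θ hθ)) :=
    Integrable.of_bound hFm.aestronglyMeasurable (Cf * Cf) (ae_of_all _ fun p => norm_mul_conj_le hfb _ _)
  rw [Measure.integral_compProd hFi]
  have inner : ∀ ω, ∫ q, f ((ω, q).1, (ω, q).2.1) * conj (f (θ (ω, q).1, (ω, q).2.2))
      ∂((κ ×ₖ κ.comap θ hθ) ω) = (∫ y, f (ω, y) ∂κ ω) * conj (∫ y, f (θ ω, y) ∂κ (θ ω)) := by
    intro ω
    exact integral_prod_comap_eq κ hθ f ω
  simp_rw [inner]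
  exact hRP

/-- **(T1) + (T2): THE SAME WITH A THIRD, ARBITRARY («CROSSING») MARKOV KERNEL ADDED** — the crossing coordinate is
invisible to the reflected product observable, so reflection positivity survives any further Markov extension
`η` of the reflected-pair measure (in the road: the crossing block bonds of the same level, whose kernel may read
anything). [folklore] -/
theorem rp_compProd_prod_comap_crossing (μ : Measure Ω) [IsFiniteMeasure μ] {θ : Ω → Ω} (hθ : Measurable θ)
    (κ : Kernel Ω Y) [IsMarkovKernel κ] (η : Kernel (Ω × (Y × Y)) Z) [IsMarkovKernel η]
    {f : Ω × Y → ℂ} (hf : Measurable f) {Cf : ℝ} (hfb : ∀ p, ‖f p‖ ≤ Cf)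
    (hRP : 0 ≤ ∫ ω, (∫ y, f (ω, y) ∂κ ω) * conj (∫ y, f (θ ω, y) ∂κ (θ ω)) ∂μ) :
    0 ≤ ∫ p, f (p.1.1, p.1.2.1) * conj (f (θ p.1.1, p.1.2.2)) ∂((μ ⊗ₘ (κ ×ₖ κ.comap θ hθ)) ⊗ₘ η) := by
  have hFm : Measurable fun p : Ω × (Y × Y) => f (p.1, p.2.1) * conj (f (θ p.1, p.2.2)) :=
    (hf.comp (measurable_fst.prodMk (measurable_fst.comp measurable_snd))).mul
      (Complex.continuous_conj.measurable.comp
        (hf.comp ((hθ.comp measurable_fst).prodMk (measurable_snd.comp measurable_snd))))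
  rw [integral_fst_compProd_markov (μ ⊗ₘ (κ ×ₖ κ.comap θ hθ)) η
    (g := fun p : Ω × (Y × Y) => f (p.1, p.2.1) * conj (f (θ p.1, p.2.2))) hFm.aestronglyMeasurable]
  exact rp_compProd_prod_comap μ hθ κ hf hfb hRP

end

end Summit.QuantumFields.BalabanUV.T4Continuum.HistoryRPTensor
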